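import Literature.Probability.RandomPlanarGeometry.SAWZdLateralClassCensus
import HarnessLib

/-!
# The WEIGHTED lateral axis-class census on `ℤ^{d+1}`: for any laterally symmetric class of self-avoiding walks and any laterally INVARIANT integer weight,
# `Σ_{class} w` is an INTEGER POLYNOMIAL IN `2d` — with the orbit-sum lemma for free actions, the weighted binomial identity, normal form and dimension congruence

Topic `Literature/Probability/RandomPlanarGeometry` (continues `SAWZdLateralClassCensus.lean` — the unweighted (counting) version: `card_lateralClass_eq_of_extend`,
`card_allAxes_filter_eq_zero_of_lt`, …; uses `SAWPulledLargeForceExpansionZdHyperoctahedral`: `latRelabel`, `latRelabel_free`, `comp_latRelabel_mem_saws_iff`,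
`forall_exists_latRelabel_iff`; `SAWPulledLargeForceExpansionZdCostPolynomial.extend_mem_saws_iff`).

PRINTED CONTEXT (locators only). Madras–Slade (1993) §1.1 eq. (1.1.8) (the `1/d` expansion), eq. (1.1.4) (mean-square displacement); Clisby–Liang–Slade (2007) §3.3
(enumeration data, incl. `⟨R_n²⟩`, in all dimensions); Graham (2010) §4 (free action of the `2^D D!` signed permutations). NOT IN PRINT (lane statements): the device of
`SAWZdLateralClassCensus` survives replacing COUNTS by SUMS OF AN INVARIANT WEIGHT (e.g. `(ω(n)·e₀)²`, the span of a bridge, any function of the height profile):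

* ★ `card_dvd_sum_of_free_action` — for a free action of a finite family `𝒢` of maps on an invariant finite set `S` and a `𝒢`-INVARIANT `f`: `|𝒢| ∣ Σ_{s ∈ S} f(s)`
  (every orbit has `|𝒢|` points with the same value; the weighted twin of the tree's `card_dvd_card_of_free_action`);
* ★ `sum_lateralClass_eq_of_extend` (weighted class identity), `sum_allAxes_filter_eq_zero_of_lt`, ★★★ `sum_filter_saws_eq_sum_choose_mul`
  (**`Σ_{Ω ∈ SAW_n(ℤ^{d+1}), P} w(Ω) = Σ_{u ≤ n} C(d,u)·W_P(u)`**), ★★ `two_pow_mul_factorial_dvd_sum_filter_allAxes` (**`2^u·u! ∣ W_P(u)`**),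
  ★★★ `exists_int_polynomial_sum_filter_saws` (**`Σ w = Q(2d)`, `Q ∈ ℤ[X]`, `deg ≤ n`, `Q(0)` = the `ℤ¹` sum**), ★★★ `dvd_sub_sum_filter_saws`
  (**`4dd′(d−d′) ∣ d′(M(d) − M(0)) − d(M(d′) − M(0))`**).
Instances (second moments, total bridge span) are in `SAWZdMomentsIntegrality.lean`.
[cite: MadrasSlade1993, §1.1 eq. (1.1.4), eq. (1.1.8) p. 5] [cite: ClisbyLiangSlade2007, §3.3] [cite: Graham2010, Section 4]

Provenance: lane «pcv-sawmu», a-p3 g25 (2026-08-28). PURE STD, no data, no definitions (three private plumbing copies).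
-/

noncomputable section

open Finset
open scoped BigOperators
open Literature.Probability.LatticeModels
open Literature.Probability.RandomPlanarGeometry.SAW

namespace Literature.Probability.RandomPlanarGeometry.SAW.Zd

/-! ## §18 The WEIGHTED lateral axis-class census: invariant weights summed over a laterally symmetric class are integer polynomials in `2d` -/

section WPlumbing

variable {u d : ℕ} {e : Fin (u + 1) → Fin (d + 1)}

/-- The zero-extension agrees with `x` on the image coordinates. [folklore] -/
private theorem wext_apply_image (he : Function.Injective e) (x : Site (u + 1)) (a : Fin (u + 1)) :
    Function.extend e x 0 (e a) = x a :=
  he.extend_apply _ _ _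

/-- The zero-extension vanishes off the image coordinates. [folklore] -/
private theorem wext_apply_of_not_exists (x : Site (u + 1)) {j : Fin (d + 1)} (hj : ¬ ∃ a, e a = j) :
    Function.extend e x 0 j = 0 := by
  rw [Function.extend_apply' _ _ _ hj]; rfl

/-- A self-avoiding walk is frozen after time `n`: a coordinate vanishing up to time `n` vanishes always. [folklore] -/
private theorem wapply_eq_zero_of_forall_le {D n : ℕ} {ω : ℕ → Site D} (hω : ω ∈ saws D n) {j : Fin D}
    (h : ∀ i ≤ n, ω i j = 0) (i : ℕ) : ω i j = 0 := by
  by_cases hi : i ≤ n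
  · exact h i hi
  · rw [(mem_saws.1 hω).2.1 i (by omega)]
    exact h n le_rfl

end WPlumbing

section FreeSum

/-- ★ ORBIT SUMS FOR A FREE ACTION: a nonempty finite family of maps closed under composition and inverses, acting freely on an invariant finite set `S`,
and a function `f` INVARIANT under the family: `|𝒢| ∣ Σ_{s ∈ S} f(s)` (every orbit has `|𝒢|` points carrying the same value). The weighted form of
`card_dvd_card_of_free_action`. [cite: Graham2010, Section 4] -/
theorem card_dvd_sum_of_free_action {G Y : Type*} [DecidableEq Y] (𝒢 : Finset G)
    (act : G → Y → Y) (hne : 𝒢.Nonempty)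
    (hmul : ∀ g ∈ 𝒢, ∀ h ∈ 𝒢, ∃ k ∈ 𝒢, ∀ y, act k y = act g (act h y))
    (hinv : ∀ g ∈ 𝒢, ∃ k ∈ 𝒢, ∀ y, act k (act g y) = y) (f : Y → ℤ) (hf : ∀ g ∈ 𝒢, ∀ y, f (act g y) = f y) (S : Finset Y)
    (hS : ∀ g ∈ 𝒢, ∀ s ∈ S, act g s ∈ S)
    (hfree : ∀ g ∈ 𝒢, ∀ h ∈ 𝒢, ∀ s ∈ S, act g s = act h s → g = h) :
    (𝒢.card : ℤ) ∣ ∑ s ∈ S, f s := by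
  induction S using Finset.strongInduction with
  | H S ih =>
    rcases S.eq_empty_or_nonempty with hS0 | ⟨s, hs⟩
    · rw [hS0, Finset.sum_empty]
      exact dvd_zero _
    set O : Finset Y := 𝒢.image fun g => act g s with hO
    have hOS : O ⊆ S := by
      intro y hy
      obtain ⟨g, hg, rfl⟩ := mem_image.1 hy
      exact hS g hg s hs
    have hOcard : O.card = 𝒢.card :=
      card_image_of_injOn fun g hg h hh e => hfree g hg h hh s hs e
    have hOne : O.Nonempty := by
      obtain ⟨g, hg⟩ := hne
      exact ⟨act g s, mem_image_of_mem _ hg⟩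
    have hOsum : ∑ y ∈ O, f y = (𝒢.card : ℤ) * f s := by
      rw [hO, Finset.sum_image fun g hg h hh e => hfree g hg h hh s hs e]
      rw [Finset.sum_congr rfl fun g hg => hf g hg s, Finset.sum_const, nsmul_eq_mul]
    have hS' : ∀ g ∈ 𝒢, ∀ t ∈ S \ O, act g t ∈ S \ O := by
      intro g hg t ht
      have ht1 : t ∈ S := (mem_sdiff.1 ht).1
      have ht2 : t ∉ O := (mem_sdiff.1 ht).2
      refine mem_sdiff.2 ⟨hS g hg t ht1, fun hmem => ht2 ?_⟩
      obtain ⟨h, hh, he⟩ := mem_image.1 hmem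
      obtain ⟨k, hk, hkinv⟩ := hinv g hg
      obtain ⟨m, hm, hme⟩ := hmul k hk h hh
      rw [hO, mem_image]
      exact ⟨m, hm, by rw [hme, he, hkinv]⟩
    have hdvd : (𝒢.card : ℤ) ∣ ∑ y ∈ S \ O, f y :=
      ih (S \ O) (sdiff_ssubset hOS hOne) hS' fun g hg h hh t ht e => hfree g hg h hh t (mem_sdiff.1 ht).1 e
    rw [← Finset.sum_sdiff hOS, hOsum]
    exact dvd_add hdvd (dvd_mul_right _ _)

end FreeSum

section WGeneric

variable {n : ℕ} (P : ∀ D : ℕ, (ℕ → Site (D + 1)) → Prop) (w : ∀ D : ℕ, (ℕ → Site (D + 1)) → ℤ)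

/-- ★ WEIGHTED CLASS IDENTITY: for a property `P` and a weight `w` both transported by the lateral zero-extensions, the `w`-sum over the walks of `ℤ^{d+1}` with `P`
using exactly the lateral axes `S` equals the `w`-sum over the «all axes used» `P`-class of `ℤ^{|S|+1}`. [cite: MadrasSlade1993, §1.1 eq. (1.1.8) p. 5] [cite: Graham2010, Section 4] -/
theorem sum_lateralClass_eq_of_extend
    (hPext : ∀ {u d : ℕ} {e : Fin (u + 1) → Fin (d + 1)}, Function.Injective e → e 0 = 0 →
      ∀ ω : ℕ → Site (u + 1), P d (fun i => Function.extend e (ω i) 0) ↔ P u ω)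
    (hwext : ∀ {u d : ℕ} {e : Fin (u + 1) → Fin (d + 1)}, Function.Injective e → e 0 = 0 →
      ∀ ω : ℕ → Site (u + 1), w d (fun i => Function.extend e (ω i) 0) = w u ω)
    {d u : ℕ} (S : Finset (Fin (d + 1))) (h0 : (0 : Fin (d + 1)) ∉ S) (hS : S.card = u) :
    open Classical in
    ∑ Ω ∈ ((saws (d + 1) n).filter fun (Ω : ℕ → Site (d + 1)) => P d Ω ∧
        (Finset.univ.filter fun (j : Fin (d + 1)) => j ≠ 0 ∧ ∃ i ≤ n, Ω i j ≠ (0 : ℤ)) = S), w d Ω =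
    ∑ ω ∈ ((saws (u + 1) n).filter fun (ω : ℕ → Site (u + 1)) => P u ω ∧
        ∀ a : Fin (u + 1), a ≠ 0 → ∃ i ≤ n, ω i a ≠ (0 : ℤ)), w u ω := by
  classical
  set T : Finset (Fin (d + 1)) := insert 0 S with hTdef
  have hT : T.card = u + 1 := by rw [hTdef, Finset.card_insert_of_notMem h0, hS]
  set e : Fin (u + 1) → Fin (d + 1) := fun a => T.orderEmbOfFin hT a with hedef
  have he : Function.Injective e := fun a b h => (T.orderEmbOfFin hT).injective h
  have hmemT : ∀ a, e a ∈ T := fun a => Finset.orderEmbOfFin_mem T hT a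
  have hrange : ∀ j, j ∈ T → ∃ a, e a = j := by
    intro j hj
    have : j ∈ Set.range (T.orderEmbOfFin hT) := by rw [Finset.range_orderEmbOfFin]; exact hj
    obtain ⟨a, ha⟩ := this
    exact ⟨a, ha⟩
  have he0 : e 0 = 0 := by
    have h1 : e 0 = T.min' ⟨0, Finset.mem_insert_self 0 S⟩ := by
      rw [hedef]
      exact Finset.orderEmbOfFin_zero hT (Nat.succ_pos u)
    rw [h1]
    exact le_antisymm (Finset.min'_le T 0 (Finset.mem_insert_self 0 S)) (Fin.zero_le _)
  have hea0 : ∀ a, e a = 0 ↔ a = 0 := fun a => ⟨fun h => he (h.trans he0.symm), fun h => by rw [h, he0]⟩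
  have hS_iff : ∀ j, j ∈ S ↔ j ∈ T ∧ j ≠ 0 := by
    intro j
    rw [hTdef, Finset.mem_insert]
    constructor
    · intro hj; exact ⟨Or.inr hj, fun h => h0 (h ▸ hj)⟩
    · rintro ⟨h | h, hne⟩
      · exact absurd h hne
      · exact h
  symm
  refine Finset.sum_nbij' (fun (ω : ℕ → Site (u + 1)) (k : ℕ) => Function.extend e (ω k) (0 : Fin (d + 1) → ℤ))
    (fun (Ω : ℕ → Site (d + 1)) (k : ℕ) (a : Fin (u + 1)) => Ω k (e a)) ?_ ?_ ?_ ?_ ?_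
  · -- maps into the class of `S`
    intro ω hω
    rw [Finset.mem_filter] at hω ⊢
    obtain ⟨hωs, hωP, hall⟩ := hω
    refine ⟨(extend_mem_saws_iff he ω).2 hωs, (hPext he he0 ω).2 hωP, ?_⟩
    ext j
    simp only [Finset.mem_filter, Finset.mem_univ, true_and]
    constructor
    · rintro ⟨hj0, i, hi, hne⟩
      have hjT : ∃ a, e a = j := by
        by_contra hne'
        exact hne (wext_apply_of_not_exists _ hne')
      obtain ⟨a, rfl⟩ := hjT
      exact (hS_iff _).2 ⟨hmemT a, hj0⟩
    · intro hj
      obtain ⟨a, rfl⟩ := hrange j ((hS_iff j).1 hj).1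
      have ha0 : a ≠ 0 := fun h => ((hS_iff _).1 hj).2 ((hea0 a).2 h)
      obtain ⟨i, hi, hne⟩ := hall a ha0
      exact ⟨fun h => ha0 ((hea0 a).1 h), i, hi, by rwa [wext_apply_image he]⟩
  · -- the restriction maps into the «all axes used» class
    intro Ω hΩ
    rw [Finset.mem_filter] at hΩ ⊢
    obtain ⟨hsaw, hΩP, hLU⟩ := hΩ
    have hext : (fun k => Function.extend e (fun a => Ω k (e a)) (0 : Fin (d + 1) → ℤ)) = Ω := by
      funext k j
      by_cases hj : ∃ a, e a = j
      · obtain ⟨a, rfl⟩ := hj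
        rw [wext_apply_image he]
      · rw [wext_apply_of_not_exists _ hj]
        have hjS : j ∉ S := fun h => hj (hrange j ((hS_iff j).1 h).1)
        by_cases hj0 : j = 0
        · exact absurd ⟨0, he0.trans hj0.symm⟩ hj
        · rw [← hLU] at hjS
          simp only [Finset.mem_filter, Finset.mem_univ, true_and, not_and, not_exists] at hjS
          symm
          refine wapply_eq_zero_of_forall_le hsaw (fun i hi => ?_) k
          simpa using hjS hj0 i hi
    refine ⟨(extend_mem_saws_iff he _).1 (by rw [hext]; exact hsaw), (hPext he he0 _).1 (by rw [hext]; exact hΩP), ?_⟩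
    intro a ha0
    have haS : e a ∈ S := (hS_iff _).2 ⟨hmemT a, fun h => ha0 ((hea0 a).1 h)⟩
    rw [← hLU, Finset.mem_filter] at haS
    exact haS.2.2
  · -- left inverse
    intro ω _
    funext k a
    exact wext_apply_image he (ω k) a
  · -- right inverse
    intro Ω hΩ
    rw [Finset.mem_filter] at hΩ
    obtain ⟨hsaw, -, hLU⟩ := hΩ
    funext k j
    show Function.extend e (fun a => Ω k (e a)) (0 : Fin (d + 1) → ℤ) j = Ω k j
    by_cases hj : ∃ a, e a = j
    · obtain ⟨a, rfl⟩ := hj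
      rw [wext_apply_image he]
    · rw [wext_apply_of_not_exists _ hj]
      have hjS : j ∉ S := fun h => hj (hrange j ((hS_iff j).1 h).1)
      by_cases hj0 : j = 0
      · exact absurd ⟨0, he0.trans hj0.symm⟩ hj
      · rw [← hLU] at hjS
        simp only [Finset.mem_filter, Finset.mem_univ, true_and, not_and, not_exists] at hjS
        symm
        refine wapply_eq_zero_of_forall_le hsaw (fun i hi => ?_) k
        simpa using hjS hj0 i hi
  · -- weights agree
    intro ω _
    exact (hwext he he0 ω).symm

/-- The «all axes used» class is empty when `u > n`, so its weighted sum vanishes. [cite: MadrasSlade1993, §4.2 eq. (4.2.20)–(4.2.22) (cost ≤ length)] -/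
theorem sum_allAxes_filter_eq_zero_of_lt {u : ℕ} (hu : n < u) :
    open Classical in
    ∑ ω ∈ ((saws (u + 1) n).filter fun (ω : ℕ → Site (u + 1)) => P u ω ∧
        ∀ a : Fin (u + 1), a ≠ 0 → ∃ i ≤ n, ω i a ≠ (0 : ℤ)), w u ω = 0 := by
  classical
  have h := card_allAxes_filter_eq_zero_of_lt (n := n) P hu
  rw [Finset.card_eq_zero] at h
  rw [h, Finset.sum_empty]

/-- ★★★ THE WEIGHTED AXIS-CLASS IDENTITY: for `P`, `w` transported by the lateral zero-extensions,
`Σ_{Ω ∈ SAW_n(ℤ^{d+1}), P} w(Ω) = Σ_{u=0}^{n} C(d,u) · W_P(u)` for EVERY `d`, with `W_P(u)` the `w`-sum over the «all axes used» `P`-class of `ℤ^{u+1}` (independent of `d`).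
[cite: MadrasSlade1993, §1.1 eq. (1.1.8) p. 5] [cite: Graham2010, Section 4] -/
theorem sum_filter_saws_eq_sum_choose_mul
    (hPext : ∀ {u d : ℕ} {e : Fin (u + 1) → Fin (d + 1)}, Function.Injective e → e 0 = 0 →
      ∀ ω : ℕ → Site (u + 1), P d (fun i => Function.extend e (ω i) 0) ↔ P u ω)
    (hwext : ∀ {u d : ℕ} {e : Fin (u + 1) → Fin (d + 1)}, Function.Injective e → e 0 = 0 →
      ∀ ω : ℕ → Site (u + 1), w d (fun i => Function.extend e (ω i) 0) = w u ω) (d : ℕ) :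
    open Classical in
    ∑ Ω ∈ ((saws (d + 1) n).filter fun (Ω : ℕ → Site (d + 1)) => P d Ω), w d Ω =
      ∑ u ∈ Finset.range (n + 1), (d.choose u : ℤ) *
        ∑ ω ∈ ((saws (u + 1) n).filter fun (ω : ℕ → Site (u + 1)) => P u ω ∧
          ∀ a : Fin (u + 1), a ≠ 0 → ∃ i ≤ n, ω i a ≠ (0 : ℤ)), w u ω := by
  classical
  set W := (saws (d + 1) n).filter (fun (Ω : ℕ → Site (d + 1)) => P d Ω) with hW
  set Pw := ((Finset.univ : Finset (Fin (d + 1))).filter (fun j => j ≠ 0)).powerset with hPw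
  set ax : (ℕ → Site (d + 1)) → Finset (Fin (d + 1)) := fun Ω => Finset.univ.filter fun (j : Fin (d + 1)) => j ≠ 0 ∧ ∃ i ≤ n, Ω i j ≠ (0 : ℤ) with hax
  have hmaps : ∀ Ω ∈ W, ax Ω ∈ Pw := by
    intro Ω _
    rw [hPw, Finset.mem_powerset]
    intro j hj
    simp only [hax, Finset.mem_filter, Finset.mem_univ, true_and] at hj ⊢
    exact hj.1
  have hsplit : ∑ Ω ∈ W, w d Ω = ∑ u ∈ Finset.range (d + 1), (d.choose u : ℤ) *
      ∑ ω ∈ ((saws (u + 1) n).filter fun (ω : ℕ → Site (u + 1)) => P u ω ∧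
        ∀ a : Fin (u + 1), a ≠ 0 → ∃ i ≤ n, ω i a ≠ (0 : ℤ)), w u ω := by
    rw [← Finset.sum_fiberwise_of_maps_to hmaps]
    have hfib : ∀ S ∈ Pw, ∑ Ω ∈ W.filter (fun Ω => ax Ω = S), w d Ω =
        ∑ ω ∈ ((saws (S.card + 1) n).filter fun (ω : ℕ → Site (S.card + 1)) => P S.card ω ∧
          ∀ a : Fin (S.card + 1), a ≠ 0 → ∃ i ≤ n, ω i a ≠ (0 : ℤ)), w S.card ω := by
      intro S hS
      rw [hPw, Finset.mem_powerset] at hS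
      have h0 : (0 : Fin (d + 1)) ∉ S := fun h => by simpa using (Finset.mem_filter.1 (hS h)).2
      rw [hW, Finset.filter_filter]
      exact sum_lateralClass_eq_of_extend P w hPext hwext S h0 rfl
    rw [Finset.sum_congr rfl hfib]
    have hcard : ((Finset.univ : Finset (Fin (d + 1))).filter (fun j => j ≠ 0)).card = d := by
      rw [Finset.filter_ne' Finset.univ (0 : Fin (d + 1)), Finset.card_erase_of_mem (Finset.mem_univ _),
        Finset.card_univ, Fintype.card_fin, Nat.add_sub_cancel]
    have hsum := Finset.sum_powerset_apply_card
      (fun u : ℕ => ∑ ω ∈ ((saws (u + 1) n).filter fun (ω : ℕ → Site (u + 1)) => P u ω ∧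
        ∀ a : Fin (u + 1), a ≠ 0 → ∃ i ≤ n, ω i a ≠ (0 : ℤ)), w u ω)
      (x := (Finset.univ : Finset (Fin (d + 1))).filter (fun j => j ≠ 0))
    rw [hcard] at hsum
    rw [hPw, hsum]
    refine Finset.sum_congr rfl fun u _ => ?_
    rw [nsmul_eq_mul]
  rw [hsplit]
  have key : ∀ K L : ℕ, (∀ u, K ≤ u → (d.choose u : ℤ) *
      ∑ ω ∈ ((saws (u + 1) n).filter fun (ω : ℕ → Site (u + 1)) => P u ω ∧
        ∀ a : Fin (u + 1), a ≠ 0 → ∃ i ≤ n, ω i a ≠ (0 : ℤ)), w u ω = 0) → K ≤ L →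
      ∑ u ∈ Finset.range K, (d.choose u : ℤ) *
        ∑ ω ∈ ((saws (u + 1) n).filter fun (ω : ℕ → Site (u + 1)) => P u ω ∧
          ∀ a : Fin (u + 1), a ≠ 0 → ∃ i ≤ n, ω i a ≠ (0 : ℤ)), w u ω =
      ∑ u ∈ Finset.range L, (d.choose u : ℤ) *
        ∑ ω ∈ ((saws (u + 1) n).filter fun (ω : ℕ → Site (u + 1)) => P u ω ∧
          ∀ a : Fin (u + 1), a ≠ 0 → ∃ i ≤ n, ω i a ≠ (0 : ℤ)), w u ω := by
    intro K L hKz hKL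
    exact Finset.sum_subset (Finset.range_mono hKL) fun u _ hu => hKz u (by simpa [Finset.mem_range] using hu)
  rw [key (d + 1) (d + n + 1) (fun u hu => by rw [Nat.choose_eq_zero_of_lt (by omega), Nat.cast_zero, zero_mul]) (by omega),
    key (n + 1) (d + n + 1) (fun u hu => by rw [sum_allAxes_filter_eq_zero_of_lt P w (by omega), mul_zero]) (by omega)]

/-- ★★ WEIGHTED HYPEROCTAHEDRAL SYMMETRY: if `P` and `w` are invariant under the signed relabellings of the lateral axes, then `2^u·u! ∣ W_P(u)`.
[cite: Graham2010, Section 4] -/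
theorem two_pow_mul_factorial_dvd_sum_filter_allAxes
    (hPrel : ∀ (u : ℕ) (g : Equiv.Perm (Fin u) × (Fin u → Bool)) (ω : ℕ → Site (u + 1)),
      ω ∈ saws (u + 1) n → (P u (fun i => latRelabel u g (ω i)) ↔ P u ω))
    (hwrel : ∀ (u : ℕ) (g : Equiv.Perm (Fin u) × (Fin u → Bool)) (ω : ℕ → Site (u + 1)),
      w u (fun i => latRelabel u g (ω i)) = w u ω) (u : ℕ) :
    open Classical in
    ((2 ^ u * u.factorial : ℕ) : ℤ) ∣ ∑ ω ∈ ((saws (u + 1) n).filter fun (ω : ℕ → Site (u + 1)) => P u ω ∧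
        ∀ a : Fin (u + 1), a ≠ 0 → ∃ i ≤ n, ω i a ≠ (0 : ℤ)), w u ω := by
  classical
  have hcard : (univ : Finset (Equiv.Perm (Fin u) × (Fin u → Bool))).card = 2 ^ u * u.factorial := by
    rw [card_univ, Fintype.card_prod, Fintype.card_perm, Fintype.card_fun, Fintype.card_bool, Fintype.card_fin, mul_comm]
  rw [← hcard]
  refine card_dvd_sum_of_free_action univ
    (fun (g : Equiv.Perm (Fin u) × (Fin u → Bool)) (ω : ℕ → Site (u + 1)) => fun i => latRelabel u g (ω i))
    univ_nonempty ?_ ?_ (w u) (fun g _ ω => hwrel u g ω) _ ?_ ?_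
  · intro g _ h _
    exact ⟨(g.1 * h.1, fun j => xor (h.2 j) (g.2 (h.1 j))), mem_univ _,
      fun ω => funext fun i => (latRelabel_latRelabel g h (ω i)).symm⟩
  · intro g _
    exact ⟨(g.1.symm, fun j => g.2 (g.1.symm j)), mem_univ _, fun ω => funext fun i => latRelabel_symm_latRelabel g (ω i)⟩
  · intro g _ ω hω
    rw [mem_filter] at hω ⊢
    exact ⟨(comp_latRelabel_mem_saws_iff g ω).2 hω.1, (hPrel u g ω hω.1).2 hω.2.1, (forall_exists_latRelabel_iff g ω).2 hω.2.2⟩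
  · intro g _ h _ ω hω heq
    rw [mem_filter] at hω
    exact latRelabel_free hω.1 hω.2.2 heq

/-- `∏_{i<u} (2d − 2i) = 2^u · d(d−1)⋯(d−u+1)` in `ℤ`. [folklore] -/
private theorem wprod_range_two_mul_sub (d : ℕ) :
    ∀ u : ℕ, ∏ i ∈ Finset.range u, (2 * (d : ℤ) - 2 * (i : ℤ)) = 2 ^ u * (d.descFactorial u : ℤ)
  | 0 => by simp
  | u + 1 => by
    rw [Finset.prod_range_succ, wprod_range_two_mul_sub d u, Nat.descFactorial_succ, pow_succ]
    rcases Nat.lt_or_ge d u with hdu | hdu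
    · rw [(Nat.descFactorial_eq_zero_iff_lt).2 hdu]
      push_cast
      ring
    · push_cast [Nat.cast_sub hdu]
      ring

/-- ★★★ WEIGHTED INTEGRALITY IN `2d`: for `P`, `w` transported by lateral zero-extensions and invariant under the signed relabellings, there is `Q ∈ ℤ[X]` of degree `≤ n`
with `Σ_{Ω ∈ SAW_n(ℤ^{d+1}), P} w(Ω) = Q(2d)` for every `d`, `Q(0)` = the sum on `ℤ¹`; equivalently the normal form `Σ_u V(u)·2^u·d(d−1)⋯(d−u+1)` with `V(u) = W_P(u)/(2^u u!) ∈ ℤ`.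
[cite: Graham2010, Section 4] [cite: MadrasSlade1993, §1.1 eq. (1.1.8) p. 5] -/
theorem exists_int_polynomial_sum_filter_saws
    (hPext : ∀ {u d : ℕ} {e : Fin (u + 1) → Fin (d + 1)}, Function.Injective e → e 0 = 0 →
      ∀ ω : ℕ → Site (u + 1), P d (fun i => Function.extend e (ω i) 0) ↔ P u ω)
    (hwext : ∀ {u d : ℕ} {e : Fin (u + 1) → Fin (d + 1)}, Function.Injective e → e 0 = 0 →
      ∀ ω : ℕ → Site (u + 1), w d (fun i => Function.extend e (ω i) 0) = w u ω)
    (hPrel : ∀ (u : ℕ) (g : Equiv.Perm (Fin u) × (Fin u → Bool)) (ω : ℕ → Site (u + 1)),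
      ω ∈ saws (u + 1) n → (P u (fun i => latRelabel u g (ω i)) ↔ P u ω))
    (hwrel : ∀ (u : ℕ) (g : Equiv.Perm (Fin u) × (Fin u → Bool)) (ω : ℕ → Site (u + 1)),
      w u (fun i => latRelabel u g (ω i)) = w u ω) :
    open Classical in
    ∃ Q : Polynomial ℤ, Q.natDegree ≤ n ∧
      Q.coeff 0 = ∑ Ω ∈ ((saws 1 n).filter fun (Ω : ℕ → Site 1) => P 0 Ω), w 0 Ω ∧
      ∀ d : ℕ, ∑ Ω ∈ ((saws (d + 1) n).filter fun (Ω : ℕ → Site (d + 1)) => P d Ω), w d Ω = Q.eval (2 * (d : ℤ)) := by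
  classical
  choose V hV using fun u => two_pow_mul_factorial_dvd_sum_filter_allAxes (n := n) P w hPrel hwrel u
  have hN : ∀ d : ℕ, ∑ Ω ∈ ((saws (d + 1) n).filter fun (Ω : ℕ → Site (d + 1)) => P d Ω), w d Ω =
      ∑ u ∈ Finset.range (n + 1), V u * (2 ^ u * (d.descFactorial u : ℤ)) := by
    intro d
    rw [sum_filter_saws_eq_sum_choose_mul P w hPext hwext d]
    refine Finset.sum_congr rfl fun u _ => ?_
    rw [hV u, Nat.descFactorial_eq_factorial_mul_choose]
    push_cast
    ring
  set Q : Polynomial ℤ := ∑ u ∈ Finset.range (n + 1), Polynomial.C (V u) *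
      ∏ i ∈ Finset.range u, (Polynomial.X - Polynomial.C (2 * (i : ℤ))) with hQdef
  have hev : ∀ d : ℕ, ∑ Ω ∈ ((saws (d + 1) n).filter fun (Ω : ℕ → Site (d + 1)) => P d Ω), w d Ω = Q.eval (2 * (d : ℤ)) := by
    intro d
    rw [hN d, hQdef, Polynomial.eval_finsetSum]
    refine Finset.sum_congr rfl fun u _ => ?_
    rw [Polynomial.eval_mul, Polynomial.eval_C, Polynomial.eval_prod]
    simp only [Polynomial.eval_sub, Polynomial.eval_X, Polynomial.eval_C]
    rw [wprod_range_two_mul_sub d u]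
  refine ⟨Q, ?_, ?_, hev⟩
  · refine Polynomial.natDegree_sum_le_of_forall_le _ _ fun u hu => ?_
    refine (Polynomial.natDegree_C_mul_le _ _).trans ((Polynomial.natDegree_prod_le _ _).trans ?_)
    calc ∑ i ∈ Finset.range u, (Polynomial.X - Polynomial.C (2 * (i : ℤ))).natDegree
        ≤ ∑ _i ∈ Finset.range u, 1 :=
          Finset.sum_le_sum (f := fun i : ℕ => (Polynomial.X - Polynomial.C (2 * (i : ℤ))).natDegree) (g := fun _ => 1)
            fun i _ => Polynomial.natDegree_X_sub_C_le (2 * (i : ℤ))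
      _ = u := by simp
      _ ≤ n := by simpa [Finset.mem_range, Nat.lt_succ_iff] using hu
  · have h0 := hev 0
    rw [Nat.cast_zero, mul_zero, ← Polynomial.coeff_zero_eq_eval_zero] at h0
    exact h0.symm

/-- ★★★ WEIGHTED DIMENSION CONGRUENCE: with `M(d) = Σ_{Ω ∈ SAW_n(ℤ^{d+1}), P} w(Ω)`, `4·d·d′·(d − d′) ∣ d′(M(d) − M(0)) − d(M(d′) − M(0))`.
[cite: Graham2010, Section 4] -/
theorem dvd_sub_sum_filter_saws
    (hPext : ∀ {u d : ℕ} {e : Fin (u + 1) → Fin (d + 1)}, Function.Injective e → e 0 = 0 →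
      ∀ ω : ℕ → Site (u + 1), P d (fun i => Function.extend e (ω i) 0) ↔ P u ω)
    (hwext : ∀ {u d : ℕ} {e : Fin (u + 1) → Fin (d + 1)}, Function.Injective e → e 0 = 0 →
      ∀ ω : ℕ → Site (u + 1), w d (fun i => Function.extend e (ω i) 0) = w u ω)
    (hPrel : ∀ (u : ℕ) (g : Equiv.Perm (Fin u) × (Fin u → Bool)) (ω : ℕ → Site (u + 1)),
      ω ∈ saws (u + 1) n → (P u (fun i => latRelabel u g (ω i)) ↔ P u ω))
    (hwrel : ∀ (u : ℕ) (g : Equiv.Perm (Fin u) × (Fin u → Bool)) (ω : ℕ → Site (u + 1)),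
      w u (fun i => latRelabel u g (ω i)) = w u ω) (d d' : ℕ) :
    open Classical in
    (4 * (d : ℤ) * d' * ((d : ℤ) - d')) ∣
      (d' : ℤ) * (∑ Ω ∈ ((saws (d + 1) n).filter fun (Ω : ℕ → Site (d + 1)) => P d Ω), w d Ω -
          ∑ Ω ∈ ((saws 1 n).filter fun (Ω : ℕ → Site 1) => P 0 Ω), w 0 Ω) -
      (d : ℤ) * (∑ Ω ∈ ((saws (d' + 1) n).filter fun (Ω : ℕ → Site (d' + 1)) => P d' Ω), w d' Ω -
          ∑ Ω ∈ ((saws 1 n).filter fun (Ω : ℕ → Site 1) => P 0 Ω), w 0 Ω) := by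
  classical
  obtain ⟨Q, -, hQ0, hQ⟩ := exists_int_polynomial_sum_filter_saws P w hPext hwext hPrel hwrel
  obtain ⟨R, hR⟩ := Polynomial.X_dvd_iff.2 (show (Q - Polynomial.C (Q.coeff 0)).coeff 0 = 0 by simp)
  obtain ⟨m, hm⟩ := Polynomial.sub_dvd_eval_sub (2 * (d : ℤ)) (2 * (d' : ℤ)) R
  have hev : ∀ e : ℕ, ∑ Ω ∈ ((saws (e + 1) n).filter fun (Ω : ℕ → Site (e + 1)) => P e Ω), w e Ω -
      ∑ Ω ∈ ((saws 1 n).filter fun (Ω : ℕ → Site 1) => P 0 Ω), w 0 Ω = 2 * (e : ℤ) * R.eval (2 * (e : ℤ)) := by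
    intro e
    have := congrArg (Polynomial.eval (2 * (e : ℤ))) hR
    rw [Polynomial.eval_sub, Polynomial.eval_C, Polynomial.eval_mul, Polynomial.eval_X, ← hQ e, hQ0] at this
    exact this
  rw [hev d, hev d']
  exact ⟨m, by linear_combination (2 * (d : ℤ) * d') * hm⟩

end WGeneric

end Literature.Probability.RandomPlanarGeometry.SAW.Zd

end
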